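import Summits.ValiantsHypothesis.ValiantsHypothesis.Theorems.LiftNullstellensatzLiftWidthGeThree

/-!
# Route LiftNullstellensatz — `LiftWidthPerFour` (item stmt-ValiantsHypothesis-5922): reduction of
the route decl to product-rank statements

`LiftWidthPerFour` says: every word tensor `Ψ : ([4]×[4])^4 → ℂ` whose commutative image is
`per_4` has SOME sequential flattening of rank `≥ 6` (no homogeneous ABP of format
`(≤5, ≤5, ≤5)` for `per_4`; Grenet's `(4, 6, 4)` would then be optimal in the middle).

This file records the (easy, Nisan-direction) reductions used by every attack on the item:

* `exists_sum_mul_of_rank_flattening` — a cut `k | l` of rank `r` of a word tensor with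
  commutative image `f` writes `f = Σ_{i<r} g_i h_i` with `g_i` (resp. `h_i`) a FORM of degree
  `k` (resp. `l`) (rank factorisation of the flattening; the tree's
  `exists_mul_eq_of_rank_eq` and `sum_word_eq_sum_append`).
* `liftWidthPerFour_of_forall_sum_mul_ne` — hence `LiftWidthPerFour` follows from the single
  middle-cut statement "`per_4` is not a sum of `≤ 5` products of two quadratic forms"
  (the `(2,2)`-product rank of `per_4` is `6`; Laplace expansion along two rows shows `≤ 6`).
* `liftWidthPerFour_of_forall_cuts` — and, more economically, from the joint statement that no
  lift has all three interior cuts of rank `≤ 5` simultaneously, each cut delivered as such a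
  product decomposition of `per_4` (degrees `(1,3)`, `(2,2)`, `(3,1)`) of the SAME word tensor.

Nothing here is specific to `ℂ`.  No new definitions.
-/

noncomputable section

open MvPolynomial

namespace Summit.ValiantsHypothesis.LiftNullstellensatz

open Literature.Computability.AlgebraicComplexity

variable {σ : Type*} {F : Type*} [Field F]

/-- A linear combination of word monomials of length `k` is a form of degree `k`. [folklore] -/
theorem isHomogeneous_sum_smul_prod_X [Fintype σ] {k : ℕ} (a : (Fin k → σ) → F) :
    (∑ u : Fin k → σ, a u • ∏ s, (X (u s) : MvPolynomial σ F)).IsHomogeneous k := by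
  refine IsHomogeneous.sum _ _ _ fun u _ => ?_
  rw [smul_eq_C_mul]
  have h := IsHomogeneous.prod Finset.univ (fun s : Fin k => (X (u s) : MvPolynomial σ F))
    (fun _ => 1) fun s _ => isHomogeneous_X F (u s)
  simp only [Finset.sum_const, Finset.card_univ, Fintype.card_fin, smul_eq_mul, mul_one] at h
  exact h.C_mul _

/-- **Flattening rank = product rank (Nisan direction).**  If `M` is the `k | l` sequential
flattening of a word tensor `Ψ` of length `n = k + l` (`M (u, v) = Ψ(u ++ v)`), then the
commutative image `Σ_w Ψ(w)·x_{w_1}⋯x_{w_n}` is a sum of `rank M` products `g_i h_i` with `g_i` a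
form of degree `k` and `h_i` a form of degree `l`. [cite: Nisan1991, Lemma 1 (method)] -/
theorem exists_sum_mul_of_rank_flattening [Fintype σ] {n k l : ℕ} (h : k + l = n)
    (Ψ : (Fin n → σ) → F) :
    ∃ (g hh : Fin (Matrix.of fun (u : Fin k → σ) (v : Fin l → σ) =>
        Ψ (fun t => Fin.append u v (Fin.cast h.symm t))).rank → MvPolynomial σ F),
      (∀ i, (g i).IsHomogeneous k) ∧ (∀ i, (hh i).IsHomogeneous l) ∧
      (∑ w : Fin n → σ, Ψ w • ∏ t, (X (w t) : MvPolynomial σ F)) = ∑ i, g i * hh i := by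
  classical
  subst h
  set M : Matrix (Fin k → σ) (Fin l → σ) F :=
    Matrix.of fun (u : Fin k → σ) (v : Fin l → σ) =>
      Ψ (fun t => Fin.append u v (Fin.cast (rfl : k + l = k + l).symm t)) with hMdef
  have hM : ∀ u v, M u v = Ψ (Fin.append u v) := fun u v => rfl
  obtain ⟨A, B, hAB⟩ := exists_mul_eq_of_rank_eq M rfl
  refine ⟨fun i => ∑ u : Fin k → σ, A u i • ∏ s, X (u s),
    fun i => ∑ v : Fin l → σ, B i v • ∏ s, X (v s),
    fun i => isHomogeneous_sum_smul_prod_X _, fun i => isHomogeneous_sum_smul_prod_X _, ?_⟩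
  rw [sum_word_eq_sum_append]
  have hentry : ∀ (u : Fin k → σ) (v : Fin l → σ), Ψ (Fin.append u v) = ∑ i, A u i * B i v := by
    intro u v
    have e := congrFun (congrFun hAB u) v
    rw [Matrix.mul_apply] at e
    exact (hM u v).symm.trans e.symm
  simp only [hentry, Finset.sum_smul, Finset.sum_mul_sum]
  symm
  rw [Finset.sum_comm]
  refine Finset.sum_congr rfl fun u _ => ?_
  rw [Finset.sum_comm]
  refine Finset.sum_congr rfl fun v _ => Finset.sum_congr rfl fun i _ => ?_
  rw [smul_eq_C_mul, smul_eq_C_mul, smul_eq_C_mul, map_mul, mul_mul_mul_comm]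

/-- **Middle-cut reduction for `LiftWidthPerFour`.**  If `per_4` is not a sum of `r ≤ 5` products
of two quadratic forms (i.e. the `(2,2)`-product rank of `per_4` is `≥ 6`), then every lift of
`per_4` has its middle flattening of rank `≥ 6`, so `LiftWidthPerFour` holds.
[cite: Nisan1991, Lemma 1 (method)] -/
theorem liftWidthPerFour_of_forall_sum_mul_ne
    (H : ∀ r : ℕ, r ≤ 5 → ∀ g h : Fin r → MvPolynomial (Fin 4 × Fin 4) ℂ,
      (∀ i, (g i).IsHomogeneous 2) → (∀ i, (h i).IsHomogeneous 2) →
      perPoly (Fin 4) ℂ ≠ ∑ i, g i * h i) :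
    Summit.ValiantsHypothesis.ValiantsHypothesis.Theses.LiftNullstellensatz.LiftWidthPerFour := by
  unfold ValiantsHypothesis.Theses.LiftNullstellensatz.LiftWidthPerFour
  intro Ψ hΨ
  refine ⟨2, 2, rfl, ?_⟩
  by_contra hlt
  push Not at hlt
  obtain ⟨g, h, hg, hh, hsum⟩ := exists_sum_mul_of_rank_flattening (σ := Fin 4 × Fin 4)
    (F := ℂ) (k := 2) (l := 2) (n := 4) rfl Ψ
  rw [hΨ] at hsum
  exact H _ (by omega) g h hg hh hsum

/-- **Joint-cut reduction for `LiftWidthPerFour`.**  It suffices to refute, for every lift `Ψ` of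
`per_4`, the conjunction of the three product decompositions delivered by interior cuts of rank
`≤ 5`: `per_4 = Σ_{i<r₁} ℓ_i c_i = Σ_{i<r₂} q_i q'_i = Σ_{i<r₃} c'_i ℓ'_i` with `r₁, r₂, r₃ ≤ 5`,
`ℓ, ℓ'` linear, `q, q'` quadratic, `c, c'` cubic forms, all read off the SAME `Ψ` (so that a
refutation may use the coupling of the cuts).  This is the form in which a finite certificate
at `(n, w) = (4, 5)` closes the item. [cite: Nisan1991, Lemma 1 (method)] -/
theorem liftWidthPerFour_of_forall_cuts
    (H : ∀ Ψ : (Fin 4 → Fin 4 × Fin 4) → ℂ,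
      (∑ w : Fin 4 → Fin 4 × Fin 4, Ψ w • ∏ t, (X (w t) : MvPolynomial (Fin 4 × Fin 4) ℂ)) =
        perPoly (Fin 4) ℂ →
      ∀ r₁ r₂ r₃ : ℕ, r₁ ≤ 5 → r₂ ≤ 5 → r₃ ≤ 5 →
      ∀ (l₁ c₁ : Fin r₁ → MvPolynomial (Fin 4 × Fin 4) ℂ)
        (q₂ q₂' : Fin r₂ → MvPolynomial (Fin 4 × Fin 4) ℂ)
        (c₃ l₃ : Fin r₃ → MvPolynomial (Fin 4 × Fin 4) ℂ),
      (∀ i, (l₁ i).IsHomogeneous 1) → (∀ i, (c₁ i).IsHomogeneous 3) →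
      (∀ i, (q₂ i).IsHomogeneous 2) → (∀ i, (q₂' i).IsHomogeneous 2) →
      (∀ i, (c₃ i).IsHomogeneous 3) → (∀ i, (l₃ i).IsHomogeneous 1) →
      perPoly (Fin 4) ℂ = ∑ i, l₁ i * c₁ i → perPoly (Fin 4) ℂ = ∑ i, q₂ i * q₂' i →
      perPoly (Fin 4) ℂ ≠ ∑ i, c₃ i * l₃ i) :
    Summit.ValiantsHypothesis.ValiantsHypothesis.Theses.LiftNullstellensatz.LiftWidthPerFour := by
  unfold ValiantsHypothesis.Theses.LiftNullstellensatz.LiftWidthPerFour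
  intro Ψ hΨ
  by_contra hno
  push Not at hno
  have h13 := hno 1 3 rfl
  have h22 := hno 2 2 rfl
  have h31 := hno 3 1 rfl
  obtain ⟨l₁, c₁, hl₁, hc₁, hs₁⟩ := exists_sum_mul_of_rank_flattening (σ := Fin 4 × Fin 4)
    (F := ℂ) (k := 1) (l := 3) (n := 4) rfl Ψ
  obtain ⟨q₂, q₂', hq₂, hq₂', hs₂⟩ := exists_sum_mul_of_rank_flattening (σ := Fin 4 × Fin 4)
    (F := ℂ) (k := 2) (l := 2) (n := 4) rfl Ψ
  obtain ⟨c₃, l₃, hc₃, hl₃, hs₃⟩ := exists_sum_mul_of_rank_flattening (σ := Fin 4 × Fin 4)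
    (F := ℂ) (k := 3) (l := 1) (n := 4) rfl Ψ
  rw [hΨ] at hs₁ hs₂ hs₃
  exact H Ψ hΨ _ _ _ (by omega) (by omega) (by omega) l₁ c₁ q₂ q₂' c₃ l₃
    hl₁ hc₁ hq₂ hq₂' hc₃ hl₃ hs₁ hs₂ hs₃

end Summit.ValiantsHypothesis.LiftNullstellensatz

end
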